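import Summits.Ventures.Crystal3D.Theorems.StickyWulffConstantCoaxialWallLawIncoherentBonded
import HarnessLib

/-!
# Incoherent translation pairs VIII: BI-GENERIC offsets — the (N3) hypothesis moved from the filling to the pair

HONEST FRAMING. Venture `Summits/Ventures/Crystal3D` (cell `crystal3d-full`), helper `--supports` the crux
`CoaxialWallLaw` (stmt-Ventures-19481, `route-Ventures-StickyWulffConstant`), REGISTERED line `WallLedgerF` (planner
cf-p1), open stub `stub_coaxialTwoSlabAdhesion`.  Rung credit only; F-C1 not moved.  Corollary of `…IncoherentBonded`
(memo HOME/wall-19481-p2/F-MED-g6.md §1/§4 (i)).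

A translation pair `Λ₁ = A·Λ₀ + t₁`, `Λ₂ = A·Λ₀ + t₂` is **BI-GENERIC** when no point off both lattices is at unit distance
from four or more points of `Λ₁ ∪ Λ₂` (stated below for finite subsets, inline — no new definition).  Lane NRG's M2 gives
`≤ 3` per lattice for every pair; four contacts split between the two lattices are four sphere conditions on the three
coordinates of the point, so for each of the countably many 4-tuples of lattice points bi-genericity fails on a proper
algebraic subset of offsets `τ = A⁻¹(t₂ − t₁)`: BI-GENERIC is a full-measure strengthening of INCOHERENT.  For such a pair
EVERY filling satisfies the filling-level hypothesis (N3) of `…IncoherentBonded`, whence: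

* **`coaxialTwoSlabAdhesion_bigeneric_of_thin`** — bi-generic incoherent pair, any filling `X ⊆ Λ₁ ∪ Λ₂ ∪ F` whose third
  material is THIN in the quantitative sense `Σ_f (deg_F(f) − 6)₊ ≤ C_B (1+h) ρ` (every union of bonded monolayer rafts,
  chains, rings, isolated balls): the stub's inequality VERBATIM at `(1/2)·√(1 − ⟪L e₃, e₃⟫²)` for EVERY frame `L`.

Inputs: NONE (tree theorems only).  WHAT THIS IS NOT: the stub; nothing about commensurate (non-bi-generic) offsets —
there bonded monolayers DO lower the wall (hollow raft + bridge: `2/√3` per unit area `< φ₁`, memo §2) — nor about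
thick fillers (F-loc); F-C1 not moved.
-/

noncomputable section

namespace Summit.Ventures.Crystal3D.Theorems

open Summit.Ventures.Crystal3D Finset NearIdentity
open Literature.MathematicalPhysics.StatisticalMechanics (fccStacking barlowStacking constHagg IsHaggSeq
  contactDeficiency)
open scoped InnerProductSpace

open scoped Classical in
/-- **BI-GENERIC INCOHERENT TRANSLATION PAIRS, THIN BONDED FILLER: THE STUB'S INEQUALITY AT `½·sin θ` FOR EVERY
AXIS.**  `hgen4`: no point off both lattices has four unit contacts with `Λ₁ ∪ Λ₂` (bi-genericity, finite-subset form).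
See the module docstring. -/
theorem coaxialTwoSlabAdhesion_bigeneric_of_thin
    (A₁ : EuclideanSpace ℝ (Fin 3) ≃ₗᵢ[ℝ] EuclideanSpace ℝ (Fin 3)) (t₁ : EuclideanSpace ℝ (Fin 3))
    (A₂ : EuclideanSpace ℝ (Fin 3) ≃ₗᵢ[ℝ] EuclideanSpace ℝ (Fin 3)) (t₂ : EuclideanSpace ℝ (Fin 3))
    (htrans : A₁ '' fccStacking 1 (Real.sqrt (2 / 3)) = A₂ '' fccStacking 1 (Real.sqrt (2 / 3)))
    (hA : ∀ q ∈ fccStacking 1 (Real.sqrt (2 / 3)), ‖q + A₁.symm (t₂ - t₁)‖ ≠ 1)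
    (hgen4 : ∀ f : EuclideanSpace ℝ (Fin 3),
      f ∉ (fun q => A₁ q + t₁) '' fccStacking 1 (Real.sqrt (2 / 3)) →
      f ∉ (fun q => A₂ q + t₂) '' fccStacking 1 (Real.sqrt (2 / 3)) →
      ∀ S : Finset (EuclideanSpace ℝ (Fin 3)),
        (∀ x ∈ S, (x ∈ (fun q => A₁ q + t₁) '' fccStacking 1 (Real.sqrt (2 / 3)) ∨
          x ∈ (fun q => A₂ q + t₂) '' fccStacking 1 (Real.sqrt (2 / 3))) ∧ dist f x = 1) → S.card ≤ 3)
    (L : EuclideanSpace ℝ (Fin 3) ≃ₗᵢ[ℝ] EuclideanSpace ℝ (Fin 3)) (C_B : ℝ) :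
    ∃ C R₀ : ℝ, 1 ≤ R₀ ∧ ∀ h : ℝ, 0 ≤ h → ∀ ρ : ℝ, R₀ ≤ ρ →
      ∀ X P₁ P₂ : Finset (EuclideanSpace ℝ (Fin 3)),
      (∀ p ∈ X, ∀ q ∈ X, p ≠ q → 1 ≤ dist p q) → P₁ ⊆ X → P₂ ⊆ X \ P₁ →
      (∀ p ∈ X, -(2 * R₀) ≤ p 2 ∧ p 2 ≤ h + 2 * R₀ ∧ p 0 ^ 2 + p 1 ^ 2 ≤ ρ ^ 2) →
      (∀ p, p ∈ P₁ ↔ (p ∈ (fun q => A₁ q + t₁) '' fccStacking 1 (Real.sqrt (2 / 3)) ∧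
        -(2 * R₀) ≤ p 2 ∧ p 2 ≤ -R₀ ∧ p 0 ^ 2 + p 1 ^ 2 ≤ ρ ^ 2)) →
      (∀ p, p ∈ P₂ ↔ (p ∈ (fun q => A₂ q + t₂) '' fccStacking 1 (Real.sqrt (2 / 3)) ∧
        h + R₀ ≤ p 2 ∧ p 2 ≤ h + 2 * R₀ ∧ p 0 ^ 2 + p 1 ^ 2 ≤ ρ ^ 2)) →
      ∀ F : Finset (EuclideanSpace ℝ (Fin 3)), F ⊆ X →
      (∀ x ∈ X, x ∈ (fun q => A₁ q + t₁) '' fccStacking 1 (Real.sqrt (2 / 3)) ∨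
        x ∈ (fun q => A₂ q + t₂) '' fccStacking 1 (Real.sqrt (2 / 3)) ∨ x ∈ F) →
      (∀ f ∈ F, f ∉ (fun q => A₁ q + t₁) '' fccStacking 1 (Real.sqrt (2 / 3)) ∧
        f ∉ (fun q => A₂ q + t₂) '' fccStacking 1 (Real.sqrt (2 / 3))) →
      ∑ f ∈ F, max (((F.filter fun g => dist f g = 1).card : ℝ) - 6) 0 ≤ C_B * (1 + h) * ρ →
      ((((P₁ ×ˢ (X \ P₁)).filter fun pq => dist pq.1 pq.2 = 1).card : ℕ) : ℝ) +
        ((((P₂ ×ˢ ((X \ P₁) \ P₂)).filter fun pq => dist pq.1 pq.2 = 1).card : ℕ) : ℝ) ≤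
        contactDeficiency ((X \ P₁) \ P₂) +
          (Real.sqrt 2 / 4 * ∑ᶠ w ∈ {w ∈ fccStacking 1 (Real.sqrt (2 / 3)) | ‖w‖ = 1},
              |⟪w, A₁.symm (EuclideanSpace.single (2 : Fin 3) (1 : ℝ))⟫_ℝ| +
            Real.sqrt 2 / 4 * ∑ᶠ w ∈ {w ∈ fccStacking 1 (Real.sqrt (2 / 3)) | ‖w‖ = 1},
              |⟪w, A₂.symm (EuclideanSpace.single (2 : Fin 3) (1 : ℝ))⟫_ℝ| -
            (1 / 2 : ℝ) * Real.sqrt (1 - ⟪L (EuclideanSpace.single (2 : Fin 3) (1 : ℝ)),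
              (EuclideanSpace.single (2 : Fin 3) (1 : ℝ))⟫_ℝ ^ 2)) * Real.pi * ρ ^ 2 +
          C * (1 + h) * ρ := by
  obtain ⟨C, R₀, hR₀, hmain⟩ := coaxialTwoSlabAdhesion_incoherent_of_bonded A₁ t₁ A₂ t₂ htrans hA L C_B
  refine ⟨C, R₀, hR₀, ?_⟩
  intro h hh ρ hρ X P₁ P₂ hX hP₁X hP₂X₁ hcyl hP₁ hP₂ F hFX hF hFoff hbond
  refine hmain h hh ρ hρ X P₁ P₂ hX hP₁X hP₂X₁ hcyl hP₁ hP₂ F hFX hF hFoff ?_ hbond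
  -- (N3) for this filling from bi-genericity of the pair
  intro f hf
  obtain ⟨hf₁, hf₂⟩ := hFoff f hf
  refine hgen4 f hf₁ hf₂ _ fun x hx => ?_
  obtain ⟨hxXF, hdx⟩ := mem_filter.1 hx
  obtain ⟨hxX, hxF⟩ := mem_sdiff.1 hxXF
  refine ⟨?_, hdx⟩
  rcases hF x hxX with h1 | h2 | h3
  · exact Or.inl h1
  · exact Or.inr h2
  · exact absurd h3 hxF

end Summit.Ventures.Crystal3D.Theorems

end
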